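import Summits.QuantumFields.BalabanUV.Beta.GAN24.FieldBlockResponse
import Summits.QuantumFields.BalabanUV.Beta.GAN24.CapacitanceEndpoint
import Summits.QuantumFields.BalabanUV.Beta.GAN24.CapacitanceCancellationDefect
import Summits.QuantumFields.BalabanUV.Beta.GAN24.ReadingWeightCrossSums

/-!
# `BalabanUV.Beta.GAN24.ScaledPartFM` — binder row G-an2-4 / (CONV-C), road P1-fibre, hypothesis shape **H2 `ScaledFM`** of p1 row **P1-L09**
# `FibreUniformBound` (leaf-05-g6's CUT NOTE, journal 2026-08-20 l.3028): the N-UNIFORM SCALED FIELD–MULTIPLIER PART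
# `s_f(j)·s_m(j)·Σ_m ‖readW(m, κ, x′)‖·‖Â_κ(m)[f̂ = 0, ĉ = e_l]‖ ≤ K₂` at every real `q ∈ [−π, π]^D ∖ {0}`, every `j`

NOT IN PRINT; OUR PROOF ATTEMPT.  HONEST FRAMING (cell contract, verbatim): «discharging `BetaPertH` makes Bałaban's UV stability
UNCONDITIONAL — a real constructive-QFT result; it is NOT the continuum limit and NOT the Clay problem.»  HONEST DEPENDENCY (verbatim):
«continuum YM on T⁴ ⇐ BetaPertH ∧ nine spine estimates (0/9 proved); BetaPertH ⇐ (D1) ∧ (D4) ∧ CAP+tail; G-an2-4 gates asym, D1 and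
NE2/3/4.»  [folklore] finite-sum norm bookkeeping over the cell's landed leaves, every input BY NAME: the capacitance endpoint (p1 row L08,
`GAN24/CapacitanceEndpoint`, leaf-20), the per-alias response bound (typer row Y09a, `GAN24/FieldBlockResponse`, leaf-10), the reading-weight
cross sums (self-row Y09x*, `GAN24/ReadingWeightCrossSums`, leaf-03; typer row Y09b, `GAN24/ReadingWeightSums`, leaf-01), the alias-weight sums
of leaf P1-L06 (`GAN24/AliasWeights(+Sum)`, this lineage) and the objects of typer row T00 (`GAN24/AliasObjects`, leaf-14).  No cited fact, no wall
binder, no `def … : Prop` hypothesis, no unit sequence re-typed (`CombesThomas.sfStep/smStep` BY NAME, ref2 c2/c3); ONE displayed constant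
`fmConst D` (a closed real expression in `D`).  NOT summit progress: it discharges NOTHING of (CONV-C)'s K-slot `GAN24.CombesThomas.ConvCK 3 Lc` by
itself — it is ONE of the four scaled-part hypotheses (H1 `ScaledFF`, H2 `ScaledFM`, H3 `ScaledMF`, H4 `ScaledMM`) of leaf-05's L09 assembly
`FibreUniformBoundOfParts.fibreUniformBound_of_scaled`; 0 wall binders instantiated; NOT `BetaPertH`, NOT continuum, NOT Clay.

## Setting (binding currency = `GAN24/AliasObjects`)
Block side `N ≥ 1`, reading box `0 < M ≤ N` (at step `j`: `N = Lc^(j+1)`, `M = Lc^j`), real Brillouin momentum `q ∈ [−π, π]^D`, `q ≠ 0`,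
`p = ofRealVec q`; the field–multiplier leg of T00's closed form `kFibClosedW` reads `Σ_m readW(m, κ, x′)·Â_κ(m)` with the amplitudes `Â(m) = Ahat N p 0 (eVec l) m`
of the CONSTRAINT source `(f̂, ĉ) = (0, e_l)` (`AliasObjects` §6, `Sum.inl κ, Sum.inr l`).

## What is proved
* §1 the constraint source: `srcPhi N p 0 ĉ = ĉ`, `srcC N p 0 = 0`, `Σ_κ ‖e_l κ‖ = 1`; hence by L08 `norm_phiSol_le`/`norm_cSol_le` BY NAME
  `‖φ_κ‖ ≤ Bφ := cPP D·|q|²/N^{D+4}`, `‖c‖ ≤ Bc := cPc D·|q|²√|q|²/N^{D+4}` (`norm_phiSol_constraint_le`, `norm_cSol_constraint_le`).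
* §2 the per-alias response (Y09a `norm_Ahat_le_param` with `F_m = 0`, `S_m = N`):
  `‖Â_κ(m)‖ ≤ √D·‖χ̂(m)‖·N·Bφ/(2‖L_m‖) + ‖χ̂(m)‖·Bc/(‖L_m‖√‖L_m‖)` and its ENGINE FORM in the T-block majorant `Λ_m = N²·lapR k_m`:
  `‖readW(m)‖·‖Â_κ(m)‖ ≤ (√D N³Bφ/2)·‖readW‖‖χ̂‖/Λ_m + (N³Bc)·‖readW‖‖χ̂‖/(Λ_m√Λ_m)`.
* §3 the sums: OFF the zero alias by leaf-03's G2 `offZero_readW_chiAl_sum(_three_halves)_le`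
  (`≤ (N/M)^{D+1}·N³·(aliasWtConst D/2)·(√D Bφ + Bc)`); AT the zero alias the `|q|²` carried by `Bφ, Bc` CANCELS the `1/|q|²` of `1/Λ₀`
  (Jordan `Λ₀ ≥ (4/π²)|q|²`, row Y08s `le_sq_mul_lapR_zero`): zero term `≤ (√D cPP π² + cPc π³)/(8 N^{D+1})` — no pole, no Q-row argument needed.
* §4 THE SCALED PART: `M^{D+1}·Σ_m ‖readW‖·‖Â‖ ≤ fmConst D` for all `0 < M ≤ N`, `q ∈ [−π, π]^D ∖ {0}` (`scaled_sum_le`; `|q|² ≤ Dπ²`), and the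
  STEP FORM with the units BY NAME (`sfStep Lc j · smStep d Lc j = (Lc^j)^{d+2} = M^{D+1}`, row Y09b `sfStep_mul_smStep`):
  **`scaledFM_step`** / `scaledFM_step_of_mem_BZ` (every `d`, every `j`) and **`scaledFM_three`** (`d = 3`: the literal H2 inequality with
  `K₂ = fmConst 4`, `N`-, `j`-, `Lc`- and `q`-free).  leaf-05's named shape `FibreUniformBound.ScaledFM Lc (sfStep Lc) (smStep 3 Lc) (fmConst 4)`
  is the `∀`-closure of `scaledFM_three` (one-line wrapper on their side or in a sequel, once `FibreUniformBoundOfParts` is in the tree).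
Unit `b2b-balaban-gan24-formalise-leaf-17` (G-an2-4 swarm, leaf prover 17), 2026-08-20.  Value = bookkeeping estimate toward L09 of road P1, NOT summit progress.
-/

noncomputable section

open Complex Finset
open scoped BigOperators Real ComplexConjugate

namespace Summit.QuantumFields.BalabanUV.Beta.GAN24.ScaledPartFM

open Literature.Probability.LatticeModels (TorusSite)
open Literature.MathematicalPhysics.QuantumFieldTheory.Balaban1983to89.B4Strip (ofRealVec)
open Literature.MathematicalPhysics.QuantumFieldTheory.Balaban1983to89.B4ContourShift (BZ)
open Literature.MathematicalPhysics.QuantumFieldTheory.King1986 (momSq momSq_nonneg)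
open AliasWeights (sinWt sinWt_pos sinWt_le_one kfine)
open AliasWeightsSum (lapR lapR_nonneg aliasWtConst)
open CombesThomas (sfStep smStep)
open FibreBlockSolve (dot)
open AliasObjects (sAl sbAl chiAl LAl dAl dbAl piPerp reg readW srcPhi srcC phiSol cSol Ahat eVec conj_ofRealVec)
open FieldBlockResponse (norm_Ahat_le_param)
open CapacitanceEndpoint (norm_phiSol_le norm_cSol_le)
open CapacitanceEndpointBlocks (cPP cPc cPP_pos cPc_pos aliasWtConst_nonneg)
open CapacitanceScalarBounds (momSq_pos le_sq_mul_lapR_zero)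
open CapacitanceScalarDictionary (LAl_ofRealVec_ne_zero)
open CapacitanceCancellationDefect (momSq_le_of_abs_le)
open ReadingWeightSums (norm_readW_le_one sfStep_mul_smStep)
open ReadingWeightCrossSums (offZero_readW_chiAl_sum_le offZero_readW_chiAl_sum_three_halves_le norm_chiAl_sq_le
  norm_sbAl_eq norm_sAl_sq_le_sq norm_LAl_ofRealVec)

variable {D : ℕ} {N : ℕ} [NeZero N]

/-! ## §1 The constraint source `(f̂, ĉ) = (0, e_l)` and its capacitance multipliers -/

omit [NeZero N] in
/-- [folklore] The transverse projection of the zero block vector vanishes: `Π⊥ 0 = 0`. -/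
theorem piPerp_zero (dd db : Fin D → ℂ) (L : ℂ) : piPerp dd db L 0 = 0 := by
  funext κ
  simp [piPerp, dot]

/-- [folklore] With NO force source the right-hand side of the `φ` rows is the constraint source itself: `r_φ[f̂ = 0, ĉ] = ĉ`. -/
theorem srcPhi_zero (p : Fin D → ℂ) (chat : Fin D → ℂ) : srcPhi N p 0 chat = chat := by
  funext κ
  simp [srcPhi, piPerp_zero]

/-- [folklore] With NO force source the right-hand side of the `c` row vanishes: `r_c[f̂ = 0] = 0`. -/
theorem srcC_zero (p : Fin D → ℂ) : srcC N p (0 : TorusSite D N → Fin D → ℂ) = 0 := by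
  simp [srcC, dot]

omit [NeZero N] in
/-- [folklore] `Σ_κ ‖e_l κ‖ = 1`. -/
theorem sum_norm_eVec (l : Fin D) : ∑ κ, ‖eVec l κ‖ = 1 := by
  rw [Finset.sum_eq_single l (fun κ _ hκ => by simp [eVec, hκ]) (fun h => (h (Finset.mem_univ l)).elim)]
  simp [eVec]

section Source

variable {q : Fin D → ℝ}

/-- **CONSTRAINT-SOURCE MULTIPLIERS** [folklore]: for the source `(f̂, ĉ) = (0, e_l)`, at every real `q ∈ [−π, π]^D ∖ {0}` and `N ≥ 1`,
`‖φ_κ‖ ≤ cPP D·|q|²/N^{D+4}` (p1 row L08 `CapacitanceEndpoint.norm_phiSol_le` BY NAME with `Σ_κ‖r_φ κ‖ = 1`, `r_c = 0`). -/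
theorem norm_phiSol_constraint_le (hN : 1 ≤ N) (hq : ∀ i, |q i| ≤ π) (hq0 : q ≠ 0) (l κ : Fin D) :
    ‖phiSol N (ofRealVec q) 0 (eVec l) κ‖ ≤ cPP D * momSq q / (N : ℝ) ^ (D + 4) := by
  have h := norm_phiSol_le hN hq hq0 (0 : TorusSite D N → Fin D → ℂ) (eVec l) κ
  rw [srcPhi_zero, srcC_zero, sum_norm_eVec, norm_zero, mul_one, mul_zero, add_zero] at h
  exact h

/-- **CONSTRAINT-SOURCE GAUGE CONSTANT** [folklore]: `‖c‖ ≤ cPc D·|q|²√|q|²/N^{D+4}` (L08 `norm_cSol_le` BY NAME with `Σ_κ‖r_φ κ‖ = 1`, `r_c = 0`). -/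
theorem norm_cSol_constraint_le (hN : 1 ≤ N) (hq : ∀ i, |q i| ≤ π) (hq0 : q ≠ 0) (l : Fin D) :
    ‖cSol N (ofRealVec q) 0 (eVec l)‖ ≤ cPc D * (momSq q * Real.sqrt (momSq q)) / (N : ℝ) ^ (D + 4) := by
  have h := norm_cSol_le hN hq hq0 (0 : TorusSite D N → Fin D → ℂ) (eVec l)
  rw [srcPhi_zero, srcC_zero, sum_norm_eVec, norm_zero, mul_one, mul_zero, add_zero] at h
  exact h

end Source

/-! ## §2 The per-alias response to the constraint source -/

/-- [folklore] `‖s♭_l(m)‖ ≤ N` at real momentum (`‖s♭‖ = ‖s‖`, `‖s‖² ≤ N²`, leaf-03 BY NAME). -/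
theorem norm_sbAl_le (q : Fin D → ℝ) (m : TorusSite D N) (l : Fin D) : ‖sbAl N (ofRealVec q) m l‖ ≤ N := by
  rw [norm_sbAl_eq]
  exact (pow_le_pow_iff_left₀ (norm_nonneg _) (Nat.cast_nonneg N) two_ne_zero).1 (norm_sAl_sq_le_sq q m l)

/-- [folklore] `‖χ̂(m)‖ ≤ 1` at real momentum (`‖χ̂(m)‖² ≤ Π_i sinWt ≤ 1`, leaf-03 BY NAME). -/
theorem norm_chiAl_le_one (q : Fin D → ℝ) (m : TorusSite D N) : ‖chiAl N (ofRealVec q) m‖ ≤ 1 := by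
  have h := norm_chiAl_sq_le (N := N) q m
  have h1 : ∏ i, sinWt N (kfine N q m i) ≤ 1 :=
    Finset.prod_le_one (fun i _ => (sinWt_pos _ _).le) fun i _ => sinWt_le_one _ _
  nlinarith [norm_nonneg (chiAl N (ofRealVec q) m)]

section Response

variable {q : Fin D → ℝ}

/-- **PER-ALIAS RESPONSE TO THE CONSTRAINT SOURCE** [folklore] (typer row Y09a `FieldBlockResponse.norm_Ahat_le_param` BY NAME with `F_m = 0`,
`S_m = N`, `Bφ, Bc` of §1): for every alias class `m` (all regular at `q ≠ 0`),
`‖Â_κ(m)‖ ≤ √D·(‖χ̂(m)‖·N·Bφ)/(2‖L_m‖) + ‖χ̂(m)‖·Bc/(‖L_m‖√‖L_m‖)`. -/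
theorem norm_Ahat_constraint_le (hN : 1 ≤ N) (hq : ∀ i, |q i| ≤ π) (hq0 : q ≠ 0) (l : Fin D) (m : TorusSite D N) (κ : Fin D) :
    ‖Ahat N (ofRealVec q) 0 (eVec l) m κ‖
      ≤ Real.sqrt D * (‖chiAl N (ofRealVec q) m‖ * N * (cPP D * momSq q / (N : ℝ) ^ (D + 4))) / (2 * ‖LAl N (ofRealVec q) m‖)
        + ‖chiAl N (ofRealVec q) m‖ * (cPc D * (momSq q * Real.sqrt (momSq q)) / (N : ℝ) ^ (D + 4))
          / (‖LAl N (ofRealVec q) m‖ * Real.sqrt ‖LAl N (ofRealVec q) m‖) := by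
  have h := norm_Ahat_le_param (conj_ofRealVec q) (LAl_ofRealVec_ne_zero hN hq hq0 m) (0 : TorusSite D N → Fin D → ℂ) (eVec l)
    (Fm := 0) (Sm := (N : ℝ)) (fun l' => by simp) (fun l' => norm_sbAl_le q m l') (norm_phiSol_constraint_le hN hq hq0 l)
    (norm_cSol_constraint_le hN hq hq0 l) κ
  simpa only [zero_add] using h

/-- [folklore] **ENGINE FORM** of the per-alias bound in the T-block majorant `Λ_m = N²·lapR k_m` of leaf P1-L06 (`‖L_m‖ = lapR k_m`,
`‖L_m‖√‖L_m‖ = Λ_m√Λ_m/N³`): for every `M` and every alias class `m`,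
`‖readW(m)‖·‖Â_κ(m)‖ ≤ (√D·N³·Bφ/2)·(‖readW‖‖χ̂‖/Λ_m) + (N³·Bc)·(‖readW‖‖χ̂‖/(Λ_m√Λ_m))`. -/
theorem readW_mul_Ahat_le_engine (hN : 1 ≤ N) (hq : ∀ i, |q i| ≤ π) (hq0 : q ≠ 0) (M : ℕ) (l : Fin D) (m : TorusSite D N)
    (κ : Fin D) (x' : Fin D → ℤ) :
    ‖readW N M (ofRealVec q) m κ x'‖ * ‖Ahat N (ofRealVec q) 0 (eVec l) m κ‖
      ≤ (Real.sqrt D * (N : ℝ) ^ 3 * (cPP D * momSq q / (N : ℝ) ^ (D + 4)) / 2)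
          * (‖readW N M (ofRealVec q) m κ x'‖ * ‖chiAl N (ofRealVec q) m‖ / ((N : ℝ) ^ 2 * lapR (kfine N q m)))
        + ((N : ℝ) ^ 3 * (cPc D * (momSq q * Real.sqrt (momSq q)) / (N : ℝ) ^ (D + 4)))
          * (‖readW N M (ofRealVec q) m κ x'‖ * ‖chiAl N (ofRealVec q) m‖
              / (((N : ℝ) ^ 2 * lapR (kfine N q m)) * Real.sqrt ((N : ℝ) ^ 2 * lapR (kfine N q m)))) := by
  have hA := norm_Ahat_constraint_le hN hq hq0 l m κ
  have hL : ‖LAl N (ofRealVec q) m‖ = lapR (kfine N q m) := norm_LAl_ofRealVec q m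
  have hLpos : 0 < lapR (kfine N q m) := by
    rw [← hL]; exact norm_pos_iff.2 (LAl_ofRealVec_ne_zero hN hq hq0 m)
  have hN0 : (0 : ℝ) < N := by exact_mod_cast hN
  have hsq : Real.sqrt ((N : ℝ) ^ 2 * lapR (kfine N q m)) = N * Real.sqrt (lapR (kfine N q m)) := by
    rw [Real.sqrt_mul (sq_nonneg _), Real.sqrt_sq hN0.le]
  have hspos : 0 < Real.sqrt (lapR (kfine N q m)) := Real.sqrt_pos.2 hLpos
  set W := ‖readW N M (ofRealVec q) m κ x'‖ with hW
  set χ := ‖chiAl N (ofRealVec q) m‖ with hχ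
  set Bφ := cPP D * momSq q / (N : ℝ) ^ (D + 4) with hBφ
  set Bc := cPc D * (momSq q * Real.sqrt (momSq q)) / (N : ℝ) ^ (D + 4) with hBc
  rw [hL, hsq] at *
  calc W * ‖Ahat N (ofRealVec q) 0 (eVec l) m κ‖
      ≤ W * (Real.sqrt D * (χ * N * Bφ) / (2 * lapR (kfine N q m))
          + χ * Bc / (lapR (kfine N q m) * Real.sqrt (lapR (kfine N q m)))) :=
        mul_le_mul_of_nonneg_left hA (norm_nonneg _)
    _ = (Real.sqrt D * (N : ℝ) ^ 3 * Bφ / 2) * (W * χ / ((N : ℝ) ^ 2 * lapR (kfine N q m)))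
        + ((N : ℝ) ^ 3 * Bc) * (W * χ / (((N : ℝ) ^ 2 * lapR (kfine N q m)) * (N * Real.sqrt (lapR (kfine N q m))))) := by
        field_simp

end Response

/-! ## §3 The alias sums: off the zero alias (engine G2) and at the zero alias (the `|q|²` cancels the pole) -/

section Sums

variable {q : Fin D → ℝ}

/-- [folklore] **OFF-ZERO SUM** (leaf-03's G2 `offZero_readW_chiAl_sum_le` + `…_three_halves_le` BY NAME): for `0 < M ≤ N`,
`Σ_{m≠0} ‖readW(m)‖·‖Â_κ(m)‖ ≤ (N/M)^{D+1}·N³·(aliasWtConst D/2)·(√D·Bφ + Bc)`. -/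
theorem offZero_sum_le (hN : 1 ≤ N) {M : ℕ} (hM : 0 < M) (hMN : M ≤ N) (hq : ∀ i, |q i| ≤ π) (hq0 : q ≠ 0)
    (l κ : Fin D) (x' : Fin D → ℤ) :
    ∑ m ∈ (Finset.univ : Finset (TorusSite D N)).erase 0,
        ‖readW N M (ofRealVec q) m κ x'‖ * ‖Ahat N (ofRealVec q) 0 (eVec l) m κ‖
      ≤ ((N : ℝ) / M) ^ (D + 1) * (N : ℝ) ^ 3 * (aliasWtConst D / 2)
          * (Real.sqrt D * (cPP D * momSq q / (N : ℝ) ^ (D + 4))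
              + cPc D * (momSq q * Real.sqrt (momSq q)) / (N : ℝ) ^ (D + 4)) := by
  have h1 := offZero_readW_chiAl_sum_le (N := N) hM hMN hq κ x'
  have h2 := offZero_readW_chiAl_sum_three_halves_le (N := N) hM hMN hq κ x'
  have hP : 0 ≤ momSq q := momSq_nonneg q
  have hA0 : 0 ≤ Real.sqrt D * (N : ℝ) ^ 3 * (cPP D * momSq q / (N : ℝ) ^ (D + 4)) / 2 := by
    have := (cPP_pos D).le; positivity
  have hB0 : 0 ≤ (N : ℝ) ^ 3 * (cPc D * (momSq q * Real.sqrt (momSq q)) / (N : ℝ) ^ (D + 4)) := by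
    have := (cPc_pos D).le; positivity
  calc ∑ m ∈ (Finset.univ : Finset (TorusSite D N)).erase 0,
        ‖readW N M (ofRealVec q) m κ x'‖ * ‖Ahat N (ofRealVec q) 0 (eVec l) m κ‖
      ≤ ∑ m ∈ (Finset.univ : Finset (TorusSite D N)).erase 0,
          ((Real.sqrt D * (N : ℝ) ^ 3 * (cPP D * momSq q / (N : ℝ) ^ (D + 4)) / 2)
              * (‖readW N M (ofRealVec q) m κ x'‖ * ‖chiAl N (ofRealVec q) m‖ / ((N : ℝ) ^ 2 * lapR (kfine N q m)))
            + ((N : ℝ) ^ 3 * (cPc D * (momSq q * Real.sqrt (momSq q)) / (N : ℝ) ^ (D + 4)))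
              * (‖readW N M (ofRealVec q) m κ x'‖ * ‖chiAl N (ofRealVec q) m‖
                  / (((N : ℝ) ^ 2 * lapR (kfine N q m)) * Real.sqrt ((N : ℝ) ^ 2 * lapR (kfine N q m))))) :=
        Finset.sum_le_sum fun m _ => readW_mul_Ahat_le_engine hN hq hq0 M l m κ x'
    _ = (Real.sqrt D * (N : ℝ) ^ 3 * (cPP D * momSq q / (N : ℝ) ^ (D + 4)) / 2)
          * ∑ m ∈ (Finset.univ : Finset (TorusSite D N)).erase 0,
              ‖readW N M (ofRealVec q) m κ x'‖ * ‖chiAl N (ofRealVec q) m‖ / ((N : ℝ) ^ 2 * lapR (kfine N q m))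
        + ((N : ℝ) ^ 3 * (cPc D * (momSq q * Real.sqrt (momSq q)) / (N : ℝ) ^ (D + 4)))
          * ∑ m ∈ (Finset.univ : Finset (TorusSite D N)).erase 0,
              ‖readW N M (ofRealVec q) m κ x'‖ * ‖chiAl N (ofRealVec q) m‖
                / (((N : ℝ) ^ 2 * lapR (kfine N q m)) * Real.sqrt ((N : ℝ) ^ 2 * lapR (kfine N q m))) := by
        rw [Finset.sum_add_distrib, ← Finset.mul_sum, ← Finset.mul_sum]
    _ ≤ (Real.sqrt D * (N : ℝ) ^ 3 * (cPP D * momSq q / (N : ℝ) ^ (D + 4)) / 2) * (((N : ℝ) / M) ^ (D + 1) * aliasWtConst D)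
        + ((N : ℝ) ^ 3 * (cPc D * (momSq q * Real.sqrt (momSq q)) / (N : ℝ) ^ (D + 4)))
          * (((N : ℝ) / M) ^ (D + 1) * aliasWtConst D / 2) :=
        add_le_add (mul_le_mul_of_nonneg_left h1 hA0) (mul_le_mul_of_nonneg_left h2 hB0)
    _ = _ := by ring

/-- [folklore] **THE ZERO-ALIAS TERM HAS NO POLE**: the `|q|²` (resp. `|q|³`) carried by `Bφ` (resp. `Bc`) cancels the `1/Λ₀ ≤ π²/(4|q|²)` (resp.
`1/(Λ₀√Λ₀) ≤ π³/(8|q|³)`) of the zero block (Jordan, row Y08s `le_sq_mul_lapR_zero` BY NAME; weights `‖readW‖, ‖χ̂‖ ≤ 1`):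
`‖readW(0)‖·‖Â_κ(0)‖ ≤ (√D·cPP D·π² + cPc D·π³)/(8·N^{D+1})`. -/
theorem zero_term_le (hN : 1 ≤ N) {M : ℕ} (hM : 0 < M) (hq : ∀ i, |q i| ≤ π) (hq0 : q ≠ 0) (l κ : Fin D) (x' : Fin D → ℤ) :
    ‖readW N M (ofRealVec q) 0 κ x'‖ * ‖Ahat N (ofRealVec q) 0 (eVec l) 0 κ‖
      ≤ (Real.sqrt D * cPP D * π ^ 2 + cPc D * π ^ 3) / (8 * (N : ℝ) ^ (D + 1)) := by
  have h := readW_mul_Ahat_le_engine hN hq hq0 M l 0 κ x'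
  have hW : ‖readW N M (ofRealVec q) 0 κ x'‖ ≤ 1 := norm_readW_le_one hM q 0 κ x'
  have hχ : ‖chiAl N (ofRealVec q) 0‖ ≤ 1 := norm_chiAl_le_one q 0
  have hWχ : ‖readW N M (ofRealVec q) 0 κ x'‖ * ‖chiAl N (ofRealVec q) 0‖ ≤ 1 := mul_le_one₀ hW (norm_nonneg _) hχ
  have hWχ0 : 0 ≤ ‖readW N M (ofRealVec q) 0 κ x'‖ * ‖chiAl N (ofRealVec q) 0‖ := mul_nonneg (norm_nonneg _) (norm_nonneg _)
  have hP : 0 < momSq q := momSq_pos hq0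
  have hsP : 0 < Real.sqrt (momSq q) := Real.sqrt_pos.2 hP
  have hN0 : (0 : ℝ) < N := by exact_mod_cast hN
  have hΛ : 4 / π ^ 2 * momSq q ≤ (N : ℝ) ^ 2 * lapR (kfine N q 0) := le_sq_mul_lapR_zero hN hq
  have ha : 0 < 4 / π ^ 2 * momSq q := by positivity
  have hΛpos : 0 < (N : ℝ) ^ 2 * lapR (kfine N q 0) := lt_of_lt_of_le ha hΛ
  have hsa : Real.sqrt (4 / π ^ 2 * momSq q) = 2 / π * Real.sqrt (momSq q) := by
    rw [Real.sqrt_mul (by positivity), show (4 : ℝ) / π ^ 2 = (2 / π) ^ 2 by ring, Real.sqrt_sq (by positivity)]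
  have i1 : ‖readW N M (ofRealVec q) 0 κ x'‖ * ‖chiAl N (ofRealVec q) 0‖ / ((N : ℝ) ^ 2 * lapR (kfine N q 0))
      ≤ π ^ 2 / (4 * momSq q) := by
    calc _ ≤ 1 / ((N : ℝ) ^ 2 * lapR (kfine N q 0)) := div_le_div_of_nonneg_right hWχ hΛpos.le
      _ ≤ 1 / (4 / π ^ 2 * momSq q) := one_div_le_one_div_of_le ha hΛ
      _ = π ^ 2 / (4 * momSq q) := by field_simp
  have i2 : ‖readW N M (ofRealVec q) 0 κ x'‖ * ‖chiAl N (ofRealVec q) 0‖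
        / (((N : ℝ) ^ 2 * lapR (kfine N q 0)) * Real.sqrt ((N : ℝ) ^ 2 * lapR (kfine N q 0)))
      ≤ π ^ 3 / (8 * (momSq q * Real.sqrt (momSq q))) := by
    have hden : 4 / π ^ 2 * momSq q * Real.sqrt (4 / π ^ 2 * momSq q)
        ≤ ((N : ℝ) ^ 2 * lapR (kfine N q 0)) * Real.sqrt ((N : ℝ) ^ 2 * lapR (kfine N q 0)) :=
      mul_le_mul hΛ (Real.sqrt_le_sqrt hΛ) (Real.sqrt_nonneg _) hΛpos.le
    have hapos : 0 < 4 / π ^ 2 * momSq q * Real.sqrt (4 / π ^ 2 * momSq q) := by positivity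
    calc _ ≤ 1 / (((N : ℝ) ^ 2 * lapR (kfine N q 0)) * Real.sqrt ((N : ℝ) ^ 2 * lapR (kfine N q 0))) :=
          div_le_div_of_nonneg_right hWχ (by positivity)
      _ ≤ 1 / (4 / π ^ 2 * momSq q * Real.sqrt (4 / π ^ 2 * momSq q)) := one_div_le_one_div_of_le hapos hden
      _ = π ^ 3 / (8 * (momSq q * Real.sqrt (momSq q))) := by
          rw [hsa]
          field_simp
          ring
  have hA0 : 0 ≤ Real.sqrt D * (N : ℝ) ^ 3 * (cPP D * momSq q / (N : ℝ) ^ (D + 4)) / 2 := by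
    have := (cPP_pos D).le; positivity
  have hB0 : 0 ≤ (N : ℝ) ^ 3 * (cPc D * (momSq q * Real.sqrt (momSq q)) / (N : ℝ) ^ (D + 4)) := by
    have := (cPc_pos D).le; positivity
  calc _ ≤ _ := h
    _ ≤ (Real.sqrt D * (N : ℝ) ^ 3 * (cPP D * momSq q / (N : ℝ) ^ (D + 4)) / 2) * (π ^ 2 / (4 * momSq q))
        + ((N : ℝ) ^ 3 * (cPc D * (momSq q * Real.sqrt (momSq q)) / (N : ℝ) ^ (D + 4)))
          * (π ^ 3 / (8 * (momSq q * Real.sqrt (momSq q)))) :=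
        add_le_add (mul_le_mul_of_nonneg_left i1 hA0) (mul_le_mul_of_nonneg_left i2 hB0)
    _ = (Real.sqrt D * cPP D * π ^ 2 + cPc D * π ^ 3) / (8 * (N : ℝ) ^ (D + 1)) := by
        field_simp
        ring

/-- [folklore] **THE FULL ALIAS SUM** of the field–multiplier leg (zero term + off-zero sum): for `0 < M ≤ N`, `q ∈ [−π, π]^D ∖ {0}`,
`Σ_m ‖readW(m, κ, x′)‖·‖Â_κ(m)[0, e_l]‖ ≤ (√D cPP π² + cPc π³)/(8N^{D+1}) + (N/M)^{D+1}·N³·(aliasWtConst D/2)·(√D·Bφ + Bc)`. -/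
theorem sum_le (hN : 1 ≤ N) {M : ℕ} (hM : 0 < M) (hMN : M ≤ N) (hq : ∀ i, |q i| ≤ π) (hq0 : q ≠ 0)
    (l κ : Fin D) (x' : Fin D → ℤ) :
    ∑ m, ‖readW N M (ofRealVec q) m κ x'‖ * ‖Ahat N (ofRealVec q) 0 (eVec l) m κ‖
      ≤ (Real.sqrt D * cPP D * π ^ 2 + cPc D * π ^ 3) / (8 * (N : ℝ) ^ (D + 1))
        + ((N : ℝ) / M) ^ (D + 1) * (N : ℝ) ^ 3 * (aliasWtConst D / 2)
          * (Real.sqrt D * (cPP D * momSq q / (N : ℝ) ^ (D + 4))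
              + cPc D * (momSq q * Real.sqrt (momSq q)) / (N : ℝ) ^ (D + 4)) := by
  rw [← Finset.add_sum_erase _ _ (Finset.mem_univ (0 : TorusSite D N))]
  exact add_le_add (zero_term_le hN hM hq hq0 l κ x') (offZero_sum_le hN hM hMN hq hq0 l κ x')

end Sums

/-! ## §4 The scaled part: one displayed constant, the `M^{D+1}` form and the step form with the units BY NAME -/

/-- **THE CONSTANT `K₂` OF THE SCALED FIELD–MULTIPLIER PART** (explicit in `D`; `cPP`, `cPc` of p1 row L08, `aliasWtConst D = (5^D − 1)/4` of
leaf P1-L06): `fmConst D = (√D·cPP·π² + cPc·π³)/8 + (aliasWtConst D/2)·(√D·cPP·(Dπ²) + cPc·(Dπ²)·√(Dπ²))`. -/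
def fmConst (D : ℕ) : ℝ :=
  (Real.sqrt D * cPP D * π ^ 2 + cPc D * π ^ 3) / 8
    + aliasWtConst D / 2 * (Real.sqrt D * cPP D * (D * π ^ 2) + cPc D * ((D * π ^ 2) * Real.sqrt (D * π ^ 2)))

/-- [folklore] `0 < fmConst D`. -/
theorem fmConst_pos (D : ℕ) : 0 < fmConst D := by
  unfold fmConst
  have h1 := cPP_pos D
  have h2 := cPc_pos D
  have h3 := aliasWtConst_nonneg D
  have h4 : 0 < π ^ 3 := by positivity
  have : 0 < (Real.sqrt D * cPP D * π ^ 2 + cPc D * π ^ 3) / 8 := by positivity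
  positivity

/-- [folklore] `0 ≤ fmConst D`. -/
theorem fmConst_nonneg (D : ℕ) : 0 ≤ fmConst D := (fmConst_pos D).le

section Scaled

variable {q : Fin D → ℝ}

/-- **THE SCALED FIELD–MULTIPLIER PART, `M^{D+1}` FORM** [folklore]: for all `0 < M ≤ N` and `q ∈ [−π, π]^D ∖ {0}`,
`M^{D+1}·Σ_m ‖readW N M p m κ x′‖·‖Ahat N p 0 (e_l) m κ‖ ≤ fmConst D` — uniform in `N`, `M`, `q`, `κ`, `l`, `x′`
(`M^{D+1}·(N/M)^{D+1}·N³/N^{D+4} = 1`, `(M/N)^{D+1} ≤ 1`, `|q|² ≤ Dπ²`). -/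
theorem scaled_sum_le (hN : 1 ≤ N) {M : ℕ} (hM : 0 < M) (hMN : M ≤ N) (hq : ∀ i, |q i| ≤ π) (hq0 : q ≠ 0)
    (l κ : Fin D) (x' : Fin D → ℤ) :
    (M : ℝ) ^ (D + 1) * ∑ m, ‖readW N M (ofRealVec q) m κ x'‖ * ‖Ahat N (ofRealVec q) 0 (eVec l) m κ‖ ≤ fmConst D := by
  have h := sum_le hN hM hMN hq hq0 l κ x'
  have hN0 : (0 : ℝ) < N := by exact_mod_cast hN
  have hM0 : (0 : ℝ) < M := by exact_mod_cast hM
  have hMN' : (M : ℝ) ≤ N := by exact_mod_cast hMN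
  have hP : momSq q ≤ D * π ^ 2 := momSq_le_of_abs_le hq
  have hP0 : 0 ≤ momSq q := momSq_nonneg q
  have hr : (M : ℝ) ^ (D + 1) / (N : ℝ) ^ (D + 1) ≤ 1 :=
    div_le_one_of_le₀ (pow_le_pow_left₀ hM0.le hMN' _) (by positivity)
  have hC : 0 ≤ aliasWtConst D / 2 := by have := aliasWtConst_nonneg D; positivity
  have hN4 : (N : ℝ) ^ (D + 4) = (N : ℝ) ^ (D + 1) * (N : ℝ) ^ 3 := by rw [← pow_add]
  rw [div_pow, hN4] at h
  calc (M : ℝ) ^ (D + 1) * ∑ m, ‖readW N M (ofRealVec q) m κ x'‖ * ‖Ahat N (ofRealVec q) 0 (eVec l) m κ‖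
      ≤ (M : ℝ) ^ (D + 1) * ((Real.sqrt D * cPP D * π ^ 2 + cPc D * π ^ 3) / (8 * (N : ℝ) ^ (D + 1))
          + (N : ℝ) ^ (D + 1) / (M : ℝ) ^ (D + 1) * (N : ℝ) ^ 3 * (aliasWtConst D / 2)
            * (Real.sqrt D * (cPP D * momSq q / ((N : ℝ) ^ (D + 1) * (N : ℝ) ^ 3))
                + cPc D * (momSq q * Real.sqrt (momSq q)) / ((N : ℝ) ^ (D + 1) * (N : ℝ) ^ 3))) :=
        mul_le_mul_of_nonneg_left h (by positivity)
    _ = (Real.sqrt D * cPP D * π ^ 2 + cPc D * π ^ 3) / 8 * ((M : ℝ) ^ (D + 1) / (N : ℝ) ^ (D + 1))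
          + aliasWtConst D / 2 * (Real.sqrt D * cPP D * momSq q + cPc D * (momSq q * Real.sqrt (momSq q))) := by
        field_simp
    _ ≤ (Real.sqrt D * cPP D * π ^ 2 + cPc D * π ^ 3) / 8 * 1
          + aliasWtConst D / 2 * (Real.sqrt D * cPP D * (D * π ^ 2) + cPc D * ((D * π ^ 2) * Real.sqrt (D * π ^ 2))) := by
        refine add_le_add (mul_le_mul_of_nonneg_left hr (by have := (cPP_pos D).le; have := (cPc_pos D).le; positivity))
          (mul_le_mul_of_nonneg_left ?_ hC)
        refine add_le_add (mul_le_mul_of_nonneg_left hP (by have := (cPP_pos D).le; positivity)) ?_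
        exact mul_le_mul_of_nonneg_left (mul_le_mul hP (Real.sqrt_le_sqrt hP) (Real.sqrt_nonneg _) (by positivity))
          (cPc_pos D).le
    _ = fmConst D := by unfold fmConst; ring

end Scaled

section Step

variable {d : ℕ} (Lc : ℕ) [NeZero Lc]

/-- **H2 `ScaledFM`, STEP FORM, every `d`** [folklore]: with `N = Lc^(j+1)`, `M = Lc^j` and the units of `GAN24/CombesThomas` BY NAME
(`sfStep Lc j · smStep d Lc j = (Lc^j)^{d+2} = M^{D+1}`, row Y09b `sfStep_mul_smStep`), for every `j`, every `q ∈ [−π, π]^{d+1} ∖ {0}`, all `κ l x′`: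
`sfStep Lc j · smStep d Lc j · Σ_m ‖readW N M (ofRealVec q) m κ x′‖·‖Ahat N (ofRealVec q) 0 (eVec l) m κ‖ ≤ fmConst (d+1)`. -/
theorem scaledFM_step (j : ℕ) {q : Fin (d + 1) → ℝ} (hq : ∀ i, |q i| ≤ π) (hq0 : q ≠ 0) (κ l : Fin (d + 1))
    (x' : Fin (d + 1) → ℤ) :
    sfStep Lc j * smStep d Lc j *
        ∑ m, ‖readW (Lc ^ (j + 1)) (Lc ^ j) (ofRealVec q) m κ x'‖ * ‖Ahat (Lc ^ (j + 1)) (ofRealVec q) 0 (eVec l) m κ‖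
      ≤ fmConst (d + 1) := by
  have hLc : 1 ≤ Lc := Nat.one_le_iff_ne_zero.2 (NeZero.ne Lc)
  have hN : 1 ≤ Lc ^ (j + 1) := Nat.one_le_pow _ _ hLc
  have hM : 0 < Lc ^ j := pow_pos hLc j
  have hMN : Lc ^ j ≤ Lc ^ (j + 1) := Nat.pow_le_pow_right hLc (Nat.le_succ j)
  have h := scaled_sum_le (D := d + 1) hN hM hMN hq hq0 l κ x'
  rw [sfStep_mul_smStep]
  have e : ((Lc : ℝ) ^ j) ^ (d + 2) = ((Lc ^ j : ℕ) : ℝ) ^ (d + 1 + 1) := by push_cast; ring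
  rw [e]
  exact h

/-- [folklore] The same with the zone hypothesis in `B4ContourShift.BZ` form (`q ∈ BZ (d+1) = [−π, π]^{d+1}`, `q ≠ 0`). -/
theorem scaledFM_step_of_mem_BZ (j : ℕ) {q : Fin (d + 1) → ℝ} (hq : q ∈ BZ (d + 1)) (hq0 : q ≠ 0) (κ l : Fin (d + 1))
    (x' : Fin (d + 1) → ℤ) :
    sfStep Lc j * smStep d Lc j *
        ∑ m, ‖readW (Lc ^ (j + 1)) (Lc ^ j) (ofRealVec q) m κ x'‖ * ‖Ahat (Lc ^ (j + 1)) (ofRealVec q) 0 (eVec l) m κ‖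
      ≤ fmConst (d + 1) :=
  scaledFM_step Lc j (fun i => abs_le.mpr ⟨hq.1 i, hq.2 i⟩) hq0 κ l x'

/-- **H2 `ScaledFM` AT THE ADOPTED DIMENSION `d = 3` (`D = 4`)** [folklore]: for every `Lc ≥ 1`, `j`, `q ∈ BZ 4 ∖ {0}`, `κ l x′`,
`sfStep Lc j · smStep 3 Lc j · Σ_m ‖readW (Lc^(j+1)) (Lc^j) (ofRealVec q) m κ x′‖·‖Ahat (Lc^(j+1)) (ofRealVec q) 0 (eVec l) m κ‖ ≤ fmConst 4` — the
literal inequality of leaf-05's shape `FibreUniformBound.ScaledFM Lc (sfStep Lc) (smStep 3 Lc) (fmConst 4)`; `K₂ = fmConst 4` is `N`-, `j`-, `Lc`-, `q`-free. -/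
theorem scaledFM_three (j : ℕ) {q : Fin (3 + 1) → ℝ} (hq : q ∈ BZ (3 + 1)) (hq0 : q ≠ 0) (κ l : Fin (3 + 1))
    (x' : Fin (3 + 1) → ℤ) :
    sfStep Lc j * smStep 3 Lc j *
        ∑ m, ‖readW (Lc ^ (j + 1)) (Lc ^ j) (ofRealVec q) m κ x'‖ * ‖Ahat (Lc ^ (j + 1)) (ofRealVec q) 0 (eVec l) m κ‖
      ≤ fmConst 4 :=
  scaledFM_step_of_mem_BZ Lc j hq hq0 κ l x'

end Step

end Summit.QuantumFields.BalabanUV.Beta.GAN24.ScaledPartFM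

end
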